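import Literature.Analysis.FluidPDE.PeriodicLogEstimate
import Literature.Analysis.FluidPDE.PeriodicLowerMass
import Literature.Analysis.FluidPDE.PeriodicSwirlMeanValue
import Literature.Analysis.FluidPDE.PeriodicSupBridge
import Literature.Analysis.FluidPDE.LeiZhang2011OscillationStep
import HarnessLib

/-!
# Lei–Ren–Zhang 2019, proof of Theorem 1.1: the oscillation decay over one periodic cylinder

Analysis/FluidPDE proofs file (theorems only, no definitions, no named facts), on the discharge
path of the named fact `Literature.Analysis.FluidPDE.leiRenZhang2019_liouville_periodic`
(Z. Lei, X. Ren, Q. S. Zhang, arXiv:1902.11229 = Math. Ann. 383 (2022), Theorem 1.1). Proof of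
Theorem 1.1 (arXiv p. 9): normalise `Φ = (Γ − inf Γ)/(sup Γ − inf Γ)` (or its reflection) so
that `0 ≤ Φ ≤ 1` and `Φ|_{r=0} ≥ ½`; "By Lemma 3.1 and Lemma 3.3 we deduce that for all
`t ∈ [−κR²/4, 0]`, `−∫ζ_R²(x) ln Φ(x,t) dx ≤ MR²`. By Chebyshev's inequality, for any `0 < δ < 1`
… `|{x ∈ D_{R/2} : Φ(x,t) ≤ δ}| ≤ MR²/|ln δ|`. Since `(δ − Φ)₊` is a nonnegative Lipschitz
subsolution … we apply Lemma 2.1 … Choose a `δ` small enough we get a point-wise lower bound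
`Φ(x,t) ≥ δ/2` for `(x,t) ∈ P_{√κR/4}`. This implies
`(sup_{P_{√κR/4}} − inf_{P_{√κR/4}}) Γ ≤ (1 − σ)(sup_{P_R} − inf_{P_R}) Γ`." This file is the
periodic twin of `LeiZhang2011.oscillation_step`, combining `meanValue_inequality_periodic`
(Lemma 2.1), `lower_mass_periodic` (Lemma 3.3) and `log_estimate_periodic` (Lemma 3.1); its
output `oscillation_step_periodic` is literally the hypothesis `hOSC` of
`liouville_periodic_of_oscillation_step`, so that `leiRenZhang2019_liouville_periodic_holds` is
the three-line append to `LeiRenZhang2019PeriodicLiouville`.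

* `bundle_affine_restrict_periodic` — the periodic swirl setting at radius `ρ` for `Γ` gives the
  setting at any radius `r ≤ ρ` for `λΓ + d`;
* `sublevel_measure_le_periodic` — Chebyshev: "`|{x ∈ D_{R/2} : Φ(x,t) ≤ δ}| ≤ MR²/|ln δ|`" per
  period;
* `oscillation_step_periodic` — for every period `P`, drift bound and potential constant there
  are `θ ∈ (0,1]`, `κ ∈ [0,1)`, `ρ₀ > 0` with `osc_{Q(θρ)} Γ ≤ κ osc_{Q(ρ)} Γ` for `ρ ≥ ρ₀`.

## References

* Z. Lei, X. Ren, Q. S. Zhang, arXiv:1902.11229, proof of Theorem 1.1 (arXiv p. 9), with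
  Lemma 2.1, Lemma 3.1, Lemma 3.3. [LeiRenZhang2019]
* Z. Lei, Q. S. Zhang, arXiv:1011.5066, Cor. 3.3 and (3.8) (pp. 10–12) (tree
  `LeiZhang2011.oscillation_step`). [LeiZhang2011]
-/

noncomputable section

open MeasureTheory Set Function Filter Metric intervalIntegral InnerProductSpace
open _root_.Topology
open scoped InnerProductSpace RealInnerProductSpace NNReal ENNReal Laplacian

namespace Literature.Analysis.FluidPDE

namespace LeiRenZhang2019

open LeiZhang2011

/-! ### Affine images and restrictions of the periodic setting -/

/-- **Affine normalisation and restriction of the periodic swirl setting.** If `Γ` (with `N`,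
`b`) is in the periodic swirl setting at radius `ρ` (the data hypotheses of
`lower_mass_periodic`/`meanValue_inequality_periodic` that concern `Γ` and `N`), then for all
reals `λ, d` and every radius `0 < r ≤ ρ` so is `λΓ + d` with `N` replaced by `λN`, on the
periodic cylinder of radius `r` with the same apex (the equation is linear; time-integrated form
rebased with `integrated_eq_rebase`). Used for `Φ = (Γ − inf Γ)/(sup Γ − inf Γ)`, its reflection,
and `Φ + ε` (Lei–Ren–Zhang 2019, p. 9). [cite: LeiRenZhang2019, proof of Thm 1.1 (arXiv p. 9), the normalisation Φ] -/
theorem bundle_affine_restrict_periodic {P ρ r lam d : ℝ} (hr : 0 < r) (hrρ : r ≤ ρ)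
    {F N : ℝ → EuclideanSpace ℝ (Fin 3) → ℝ}
    {b : ℝ → EuclideanSpace ℝ (Fin 3) → EuclideanSpace ℝ (Fin 3)}
    (hF2 : ∀ s, ContDiff ℝ 2 (F s)) (hFa : ∀ s, IsAxisymmetricScalar (F s))
    (hFp : ∀ s, IsAxiallyPeriodic P (F s))
    (hN : ∀ s x, N s x =
      (Δ (F s)) x - fderiv ℝ (F s) x (b s x) - 2 / cylRadius x * fderiv ℝ (F s) x (eR x))
    (heq : ∀ᵐ x ∂(volume : Measure (EuclideanSpace ℝ (Fin 3))),
      IntervalIntegrable (fun s => N s x) volume (-ρ ^ 2) 0 ∧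
        ∀ s ∈ Icc (-ρ ^ 2) 0, F s x = F (-ρ ^ 2) x + ∫ τ in (-ρ ^ 2)..s, N τ x)
    (hFc : Continuous fun p : ℝ × EuclideanSpace ℝ (Fin 3) => F p.1 p.2)
    (hF1c : Continuous fun p : ℝ × EuclideanSpace ℝ (Fin 3) => gradient (F p.1) p.2)
    (hNm : AEStronglyMeasurable (fun p : ℝ × EuclideanSpace ℝ (Fin 3) => N p.1 p.2)
      ((volume.restrict (Ioc (-ρ ^ 2) 0)).prod volume))
    (hNi : Integrable (fun p : ℝ × EuclideanSpace ℝ (Fin 3) => N p.1 p.2)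
      ((volume.restrict (Ioc (-ρ ^ 2) 0)).prod
        (volume.restrict {x : EuclideanSpace ℝ (Fin 3) | x 2 ∈ Icc 0 (2 * P) ∧ cylRadius x ≤ ρ}))) :
    (∀ s, ContDiff ℝ 2 (fun x => lam * F s x + d)) ∧
    (∀ s, IsAxisymmetricScalar (fun x => lam * F s x + d)) ∧
    (∀ s, IsAxiallyPeriodic P (fun x => lam * F s x + d)) ∧
    (∀ s x, lam * N s x =
      (Δ (fun y => lam * F s y + d)) x - fderiv ℝ (fun y => lam * F s y + d) x (b s x) -
        2 / cylRadius x * fderiv ℝ (fun y => lam * F s y + d) x (eR x)) ∧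
    (∀ᵐ x ∂(volume : Measure (EuclideanSpace ℝ (Fin 3))),
      IntervalIntegrable (fun s => lam * N s x) volume (-r ^ 2) 0 ∧
        ∀ s ∈ Icc (-r ^ 2) 0, lam * F s x + d = (lam * F (-r ^ 2) x + d) + ∫ τ in (-r ^ 2)..s, lam * N τ x) ∧
    (Continuous fun p : ℝ × EuclideanSpace ℝ (Fin 3) => lam * F p.1 p.2 + d) ∧
    (Continuous fun p : ℝ × EuclideanSpace ℝ (Fin 3) => gradient (fun y => lam * F p.1 y + d) p.2) ∧
    AEStronglyMeasurable (fun p : ℝ × EuclideanSpace ℝ (Fin 3) => lam * N p.1 p.2)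
      ((volume.restrict (Ioc (-r ^ 2) 0)).prod volume) ∧
    Integrable (fun p : ℝ × EuclideanSpace ℝ (Fin 3) => lam * N p.1 p.2)
      ((volume.restrict (Ioc (-r ^ 2) 0)).prod
        (volume.restrict {x : EuclideanSpace ℝ (Fin 3) | x 2 ∈ Icc 0 (2 * P) ∧ cylRadius x ≤ r})) := by
  have hrr : -ρ ^ 2 ≤ -r ^ 2 := by nlinarith
  have hr0 : -r ^ 2 ≤ (0 : ℝ) := by nlinarith
  have hI : Ioc (-r ^ 2) (0 : ℝ) ⊆ Ioc (-ρ ^ 2) 0 := Ioc_subset_Ioc hrr le_rfl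
  have hbox : {x : EuclideanSpace ℝ (Fin 3) | x 2 ∈ Icc 0 (2 * P) ∧ cylRadius x ≤ r} ⊆
      {x : EuclideanSpace ℝ (Fin 3) | x 2 ∈ Icc 0 (2 * P) ∧ cylRadius x ≤ ρ} :=
    fun x hx => ⟨hx.1, hx.2.trans hrρ⟩
  have hμ₁ : (volume.restrict (Ioc (-r ^ 2) (0 : ℝ))).prod (volume : Measure (EuclideanSpace ℝ (Fin 3))) ≤
      (volume.restrict (Ioc (-ρ ^ 2) 0)).prod volume :=
    Measure.prod_mono (Measure.restrict_mono hI le_rfl) le_rfl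
  have hμ₂ : (volume.restrict (Ioc (-r ^ 2) (0 : ℝ))).prod
        ((volume : Measure (EuclideanSpace ℝ (Fin 3))).restrict
          {x : EuclideanSpace ℝ (Fin 3) | x 2 ∈ Icc 0 (2 * P) ∧ cylRadius x ≤ r}) ≤
      (volume.restrict (Ioc (-ρ ^ 2) 0)).prod
        (volume.restrict {x : EuclideanSpace ℝ (Fin 3) | x 2 ∈ Icc 0 (2 * P) ∧ cylRadius x ≤ ρ}) :=
    Measure.prod_mono (Measure.restrict_mono hI le_rfl) (Measure.restrict_mono hbox le_rfl)
  -- the affine map `v ↦ λ v + d`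
  have haff : ∀ s, (fun x => lam * F s x + d) = fun x => (fun v : ℝ => lam * v + d) (F s x) := fun s => rfl
  have haffd : ∀ v : ℝ, deriv (fun v : ℝ => lam * v + d) v = lam := by
    intro v
    rw [deriv_add_const, deriv_const_mul _ differentiableAt_id, deriv_id'', mul_one]
  have haffD : Differentiable ℝ fun v : ℝ => lam * v + d :=
    (differentiable_id.const_mul lam).add_const d
  have hF2' : ∀ s, ContDiff ℝ 2 (fun x => lam * F s x + d) := fun s =>
    (contDiff_const.mul (hF2 s)).add contDiff_const
  have hgrad : ∀ s x, gradient (fun y => lam * F s y + d) x = lam • gradient (F s) x := by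
    intro s x
    rw [haff s, gradient_comp_apply (haffD _) (((hF2 s).differentiable two_ne_zero) x), haffd]
  have hfderiv : ∀ s x, fderiv ℝ (fun y => lam * F s y + d) x = lam • fderiv ℝ (F s) x := by
    intro s x
    have hd : DifferentiableAt ℝ (F s) x := ((hF2 s).differentiable two_ne_zero) x
    rw [show (fun y => lam * F s y + d) = fun y => lam * F s y + d from rfl, fderiv_add_const,
      fderiv_const_mul hd]
  have hlap : ∀ s x, (Δ (fun y => lam * F s y + d)) x = lam * (Δ (F s)) x := by
    intro s x
    have e : (fun y => lam * F s y + d) = (lam • F s) + fun _ => d := by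
      funext y; simp [smul_eq_mul]
    have h1 : ContDiffAt ℝ 2 (lam • F s) x := ((hF2 s).const_smul lam).contDiffAt
    rw [e, h1.laplacian_add contDiffAt_const, laplacian_smul lam (hF2 s).contDiffAt, laplacian_const]
    simp [smul_eq_mul]
  refine ⟨hF2', fun s θ x => by simp only [hFa s θ x], fun s x => by simp only [hFp s x],
    fun s x => ?_, ?_, (continuous_const.mul hFc).add continuous_const, ?_, (hNm.mono_measure hμ₁).const_mul lam,
    (hNi.mono_measure hμ₂).const_mul lam⟩
  · -- the equation for `λΓ + d`
    rw [hlap, hfderiv, hN s x]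
    have e1 : (lam • fderiv ℝ (F s) x) (b s x) = lam * fderiv ℝ (F s) x (b s x) := rfl
    have e2 : (lam • fderiv ℝ (F s) x) (eR x) = lam * fderiv ℝ (F s) x (eR x) := rfl
    rw [e1, e2]
    ring
  · -- the time-integrated form, rebased at `−r²`
    filter_upwards [heq] with x hx
    obtain ⟨hi, hrep⟩ := integrated_eq_rebase (Fx := fun s => F s x) (Nx := fun s => N s x) hrr hr0 hx.1 hx.2
    refine ⟨hi.const_mul lam, fun s hs => ?_⟩
    rw [intervalIntegral.integral_const_mul, hrep s hs]
    ring
  · -- joint continuity of the gradient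
    have e : (fun p : ℝ × EuclideanSpace ℝ (Fin 3) => gradient (fun y => lam * F p.1 y + d) p.2) =
        fun p => lam • gradient (F p.1) p.2 := funext fun p => hgrad p.1 p.2
    rw [e]
    exact hF1c.const_smul lam

/-! ### The measure of the sublevel sets from the logarithmic estimate -/

/-- **The measure of a sublevel set from the logarithmic mean, per period** (Lei–Ren–Zhang 2019,
proof of Thm 1.1, (3.17): "`|{x ∈ D_{R/2} : Φ(x,t) ≤ δ}| ≤ MR²/|ln δ|`", Chebyshev). For one slice
`F` with `ε ≤ F ≤ 3` on `{r ≤ ρ}`, `0 < 2δ < 1`, `ζ = cylCutoff (ρ/2) ρ` and `P, ρ > 0`: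
`ln(1/(2δ)) · |{F < 2δ} ∩ ([0,P] × {r ≤ ρ/2})| ≤ ∫_{slab} (−ln F) ζ² + (ln 3) ∫_{slab} ζ²`
(pointwise `ln(1/(2δ)) 1_S ≤ (−ln F)ζ² + (ln 3)ζ²` on the slab, `ζ = 1` on `{r ≤ ρ/2}`). [cite: LeiRenZhang2019, proof of Thm 1.1, (3.17) (arXiv p. 9)] -/
theorem sublevel_measure_le_periodic {P ρ ε δ : ℝ} (hρ : 0 < ρ) (hε : 0 < ε) (hδ : 0 < δ)
    (hδ1 : 2 * δ < 1) {F : EuclideanSpace ℝ (Fin 3) → ℝ} (hF : Continuous F)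
    (hFb : ∀ x, cylRadius x ≤ ρ → ε ≤ F x ∧ F x ≤ 3) :
    Real.log (1 / (2 * δ)) *
        volume.real ({x | F x < 2 * δ} ∩ {x : EuclideanSpace ℝ (Fin 3) | x 2 ∈ Icc 0 P ∧ cylRadius x ≤ ρ / 2}) ≤
      (∫ x in zSlab P 0, -Real.log (F x) * cylCutoff (ρ / 2) ρ x ^ 2) +
        Real.log 3 * ∫ y in zSlab P 0, cylCutoff (ρ / 2) ρ y ^ 2 := by
  set φ : EuclideanSpace ℝ (Fin 3) → ℝ := cylCutoff (ρ / 2) ρ with hφdef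
  set L : ℝ := Real.log (1 / (2 * δ)) with hL
  set T₀ : Set (EuclideanSpace ℝ (Fin 3)) := {x | F x < 2 * δ} ∩ (zSlab P 0 ∩ {x | cylRadius x ≤ ρ / 2}) with hT₀
  have hρ2 : 0 ≤ ρ / 2 := by positivity
  have hρρ : ρ / 2 < ρ := half_lt_self hρ
  have hL0 : 0 < L := Real.log_pos (by rw [lt_div_iff₀ (by positivity)]; linarith)
  have hlog3 : 0 < Real.log 3 := Real.log_pos (by norm_num)
  have hφc : Continuous φ := (contDiff_cylCutoff (ρ / 2) ρ (n := 0)).continuous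
  have hφ2c : Continuous fun x => φ x ^ 2 := hφc.pow 2
  have hφ0 : ∀ x, ρ ≤ cylRadius x → φ x = 0 := fun x hx => cylCutoff_eq_zero hρ2 hρρ hx
  have hφK : ∀ x, ¬cylRadius x ≤ ρ → φ x = 0 := fun x hx => hφ0 x (le_of_lt (not_le.1 hx))
  have hφone : ∀ x, cylRadius x ≤ ρ / 2 → φ x = 1 := fun x hx => cylCutoff_eq_one hρ2 hρρ hx
  -- the sublevel set is the stated one a.e., measurable, of finite measure, inside the slab
  have hcyl : MeasurableSet {x : EuclideanSpace ℝ (Fin 3) | cylRadius x ≤ ρ / 2} :=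
    measurableSet_le continuous_cylRadius.measurable measurable_const
  have hT₀m : MeasurableSet T₀ :=
    (isOpen_lt hF continuous_const).measurableSet.inter ((measurableSet_zSlab P 0).inter hcyl)
  have hT₀sub : T₀ ⊆ zSlab P 0 := fun x hx => hx.2.1
  have hT₀K : T₀ ⊆ {x : EuclideanSpace ℝ (Fin 3) | x 2 ∈ Icc 0 P ∧ cylRadius x ≤ ρ / 2} := by
    intro x hx
    have h := mem_zSlab.1 hx.2.1
    simp only [Int.cast_zero, zero_mul, zero_add, one_mul] at h
    exact ⟨⟨h.1, h.2.le⟩, hx.2.2⟩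
  have hT₀fin : volume T₀ ≠ ∞ :=
    ((measure_mono hT₀K).trans_lt (isCompact_halfPeriodBox P (ρ / 2)).measure_lt_top).ne
  have hae : ({x | F x < 2 * δ} ∩ {x : EuclideanSpace ℝ (Fin 3) | x 2 ∈ Icc 0 P ∧ cylRadius x ≤ ρ / 2} :
      Set (EuclideanSpace ℝ (Fin 3))) =ᵐ[volume] T₀ :=
    (EventuallyEq.refl _ _).inter (zSlab_inter_cylinder_ae_eq_periodBox P (ρ / 2)).symm
  rw [measureReal_congr hae]
  -- pointwise: `L 1_{T₀} ≤ (−log F) φ² + (log 3) φ²`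
  have hpt : ∀ x, T₀.indicator (fun _ => L) x ≤ -Real.log (F x) * φ x ^ 2 + Real.log 3 * φ x ^ 2 := by
    intro x
    by_cases hxK : cylRadius x ≤ ρ
    · obtain ⟨hlo, hhi⟩ := hFb x hxK
      have hF0 : 0 < F x := hε.trans_le hlo
      have hlogle : Real.log (F x) ≤ Real.log 3 := Real.log_le_log hF0 hhi
      by_cases hx : x ∈ T₀
      · rw [indicator_of_mem hx, hφone x hx.2.2]
        have h1 : L ≤ -Real.log (F x) := by
          rw [hL, one_div, Real.log_inv]
          exact neg_le_neg (Real.log_le_log hF0 hx.1.le)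
        nlinarith
      · rw [indicator_of_notMem hx]
        nlinarith [sq_nonneg (φ x)]
    · have hx : x ∉ T₀ := fun h => hxK (h.2.2.trans hρρ.le)
      rw [indicator_of_notMem hx, hφK x hxK]
      simp
  -- integrate over the slab
  have hi1 : IntegrableOn (T₀.indicator fun _ => L) (zSlab P 0) volume :=
    ((integrable_indicator_iff hT₀m).2 (integrableOn_const hT₀fin)).integrableOn
  have hi2 : IntegrableOn (fun x => -Real.log (F x) * φ x ^ 2) (zSlab P 0) volume := by
    have hc : Continuous fun x => -Real.log (max ε (F x)) * φ x ^ 2 :=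
      ((continuous_const.max hF).log fun x => (hε.trans_le (le_max_left _ _)).ne').neg.mul hφ2c
    have hi := integrableOn_zSlab_of_eq_zero_of_le_cylRadius hc (ρ := ρ) (fun x hx => by simp [hφ0 x hx]) P 0
    refine hi.congr_fun (fun x _ => ?_) (measurableSet_zSlab P 0)
    show -Real.log (max ε (F x)) * φ x ^ 2 = -Real.log (F x) * φ x ^ 2
    by_cases hxK : cylRadius x ≤ ρ
    · rw [max_eq_right (hFb x hxK).1]
    · rw [hφK x hxK]; simp
  have hZi : IntegrableOn (fun x => φ x ^ 2) (zSlab P 0) volume :=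
    integrableOn_zSlab_of_eq_zero_of_le_cylRadius hφ2c (ρ := ρ) (fun x hx => by simp [hφ0 x hx]) P 0
  have hi3 : IntegrableOn (fun x => Real.log 3 * φ x ^ 2) (zSlab P 0) volume := hZi.const_mul _
  have hi23 : Integrable (fun x => -Real.log (F x) * φ x ^ 2 + Real.log 3 * φ x ^ 2)
      ((volume : Measure (EuclideanSpace ℝ (Fin 3))).restrict (zSlab P 0)) := hi2.add hi3
  calc L * volume.real T₀ = ∫ x in zSlab P 0, T₀.indicator (fun _ => L) x := by
        rw [setIntegral_indicator hT₀m, inter_eq_right.2 hT₀sub, setIntegral_const, smul_eq_mul, mul_comm]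
    _ ≤ ∫ x in zSlab P 0, (-Real.log (F x) * φ x ^ 2 + Real.log 3 * φ x ^ 2) :=
        MeasureTheory.integral_mono hi1 hi23 hpt
    _ = (∫ x in zSlab P 0, -Real.log (F x) * φ x ^ 2) + Real.log 3 * ∫ x in zSlab P 0, φ x ^ 2 := by
        rw [integral_add hi2 hi3, MeasureTheory.integral_const_mul]

/-! ### The oscillation decay over one periodic cylinder -/

/-- The closed period box `[0, L] × {r ≤ ρ}` is compact. [folklore] -/
private theorem isCompact_box_pos (L ρ : ℝ) :
    IsCompact {x : EuclideanSpace ℝ (Fin 3) | x 2 ∈ Icc 0 L ∧ cylRadius x ≤ ρ} := by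
  have hx2 : Continuous fun x : EuclideanSpace ℝ (Fin 3) => x 2 :=
    (EuclideanSpace.proj (𝕜 := ℝ) (2 : Fin 3)).continuous
  refine Metric.isCompact_of_isClosed_isBounded ?_ ?_
  · exact (isClosed_Icc.preimage hx2).inter (isClosed_le continuous_cylRadius continuous_const)
  · refine (Metric.isBounded_closedBall (x := (0 : EuclideanSpace ℝ (Fin 3))) (r := ρ + |L|)).subset
      fun x hx => ?_
    rw [mem_closedBall_zero_iff]
    have h := norm_le_cylRadius_add_abs_apply_two x
    have h2 : |x 2| ≤ |L| := by
      rw [abs_le]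
      exact ⟨by linarith [hx.1.1, abs_nonneg L], hx.1.2.trans (le_abs_self L)⟩
    linarith [hx.2]

set_option maxHeartbeats 3200000 in
-- one long assembly proof (constants, three normalised bundles, Lemma 3.3, Lemma 3.1, the
-- sublevel sets, the mean value inequality in `L⁴` per period, the choice of `δ`, the passage
-- from the `L^∞` norm to every point by periodicity, and the two cases of the normalisation)
/-- **The one-step oscillation decay of the periodic swirl setting (Lei–Ren–Zhang 2019, proof of
Theorem 1.1, (3.17)–(3.18)).** For every period `P > 0`, drift bound `M_b` and potential constant
`C_Φ` there are `θ ∈ (0, 1]`, `κ ∈ [0, 1)` and `ρ₀ > 0` such that every periodic swirl setting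
datum `(F, N, b, Φ)` at radius `ρ ≥ ρ₀` (hypotheses as output by `bundle_of_periodic_swirl_setting`)
with `m ≤ F ≤ M` on `[−ρ², 0] × {r ≤ ρ}` has oscillation at most `κ(M − m)` on
`[−(θρ)², 0] × {r ≤ θρ}` — literally the hypothesis `hOSC` of
`liouville_periodic_of_oscillation_step`. Proof as printed (p. 9): normalise `Φ = 2(Γ − m)/J` or
`2(M − Γ)/J` (`J = M − m`) so that `0 ≤ Φ ≤ 2` and `Φ ≥ 1` on the axis; Lemma 3.3
(`lower_mass_periodic`) and Lemma 3.1 (`log_estimate_periodic`) for `Φ + ε` bound the measure of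
the sublevel sets `{Φ(t) < δ}` per period (`sublevel_measure_le_periodic`); the mean value
inequality (`meanValue_inequality_periodic`, Lemma 2.1) for `(δ − Φ)₊` in `L⁴` then gives
`Φ ≥ δ/2` on the small cylinder for `δ = δ(P, C_Φ)` small and `ρ ≥ ρ₀ = P/√c_t`, i.e.
`osc ≤ (1 − δ/4) J`. [cite: LeiRenZhang2019, proof of Thm 1.1, (3.17)–(3.18) (arXiv p. 9)] -/
theorem oscillation_step_periodic :
    ∀ ⦃P : ℝ⦄, 0 < P → ∀ Mb CΦ : ℝ, ∃ θ κd ρ₀ : ℝ, 0 < θ ∧ θ ≤ 1 ∧ 0 ≤ κd ∧ κd < 1 ∧ 0 < ρ₀ ∧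
      ∀ ⦃ρ : ℝ⦄, ρ₀ ≤ ρ → ∀ ⦃F N : ℝ → EuclideanSpace ℝ (Fin 3) → ℝ⦄
        ⦃b : ℝ → EuclideanSpace ℝ (Fin 3) → EuclideanSpace ℝ (Fin 3)⦄
        ⦃Φ : ℝ → EuclideanSpace ℝ (Fin 3) → ℝ⦄,
      (∀ s, ContDiff ℝ 2 (F s)) → (∀ s, IsAxisymmetricScalar (F s)) →
      (∀ s x, cylRadius x = 0 → F s x = 0) → (∀ s, IsAxiallyPeriodic P (F s)) →
      (∀ s, ContDiff ℝ 1 (b s)) → (∀ s x, VectorCalculus.divergence (b s) x = 0) →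
      (∀ s, IsAxiallyPeriodic P (b s)) → (∀ s x, ‖b s x‖ ≤ Mb) →
      (∀ s, ContDiff ℝ 1 (Φ s)) → (∀ s, IsAxiallyPeriodic P (Φ s)) →
      (∀ s x, fderiv ℝ (Φ s) x eZ = ⟪b s x, horizPart x⟫) →
      (∀ s x, |Φ s x| ≤ CΦ * cylRadius x) →
      (∀ s x, N s x =
        (Δ (F s)) x - fderiv ℝ (F s) x (b s x) - 2 / cylRadius x * fderiv ℝ (F s) x (eR x)) →
      (∀ᵐ x ∂(volume : Measure (EuclideanSpace ℝ (Fin 3))),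
        IntervalIntegrable (fun s => N s x) volume (-ρ ^ 2) 0 ∧
          ∀ s ∈ Icc (-ρ ^ 2) 0, F s x = F (-ρ ^ 2) x + ∫ σ in (-ρ ^ 2)..s, N σ x) →
      (Continuous fun p : ℝ × EuclideanSpace ℝ (Fin 3) => F p.1 p.2) →
      (Continuous fun p : ℝ × EuclideanSpace ℝ (Fin 3) => gradient (F p.1) p.2) →
      AEStronglyMeasurable (fun p : ℝ × EuclideanSpace ℝ (Fin 3) => N p.1 p.2)
        ((volume.restrict (Ioc (-ρ ^ 2) 0)).prod volume) →
      Integrable (fun p : ℝ × EuclideanSpace ℝ (Fin 3) => N p.1 p.2)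
        ((volume.restrict (Ioc (-ρ ^ 2) 0)).prod
          (volume.restrict {x : EuclideanSpace ℝ (Fin 3) | x 2 ∈ Icc 0 (2 * P) ∧ cylRadius x ≤ ρ})) →
      ∀ ⦃m M : ℝ⦄, (∀ s ∈ Icc (-ρ ^ 2) 0, ∀ x, cylRadius x ≤ ρ → m ≤ F s x ∧ F s x ≤ M) →
      ∀ p ∈ Icc (-(θ * ρ) ^ 2) 0 ×ˢ {x : EuclideanSpace ℝ (Fin 3) | cylRadius x ≤ θ * ρ},
      ∀ q ∈ Icc (-(θ * ρ) ^ 2) 0 ×ˢ {x : EuclideanSpace ℝ (Fin 3) | cylRadius x ≤ θ * ρ},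
        F p.1 p.2 - F q.1 q.2 ≤ κd * (M - m) := by
  intro P hP Mb CΦ
  -- ### the constants depending only on `P` and `C_Φ`
  set CΦ' : ℝ := max CΦ 0 with hCΦ'
  have hCΦ'0 : 0 ≤ CΦ' := le_max_right _ _
  obtain ⟨Cmv, hCmv0, hMV⟩ := meanValue_inequality_periodic
  obtain ⟨cl, hcl0, hLM⟩ := lower_mass_periodic hCΦ'0
  obtain ⟨ct, M₀, hct0, hct8, hM₀0, hLE⟩ := log_estimate_periodic hCΦ'0 (m₀ := cl / 16) (by positivity)
  have hlog3 : 0 < Real.log 3 := Real.log_pos (by norm_num)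
  set C₁ : ℝ := M₀ + 4 * Real.log 3 with hC₁
  have hC₁0 : 0 < C₁ := by positivity
  set Cmv' : ℝ := Cmv * (1 + CΦ' ^ 2) ^ (5 / 8 : ℝ) with hCmv'
  have hCmv'0 : 0 ≤ Cmv' := by positivity
  set Lc : ℝ := 32 * Cmv' ^ 4 * C₁ / ct + 1 with hLc
  have hLc1 : 1 ≤ Lc := by
    have h : 0 ≤ 32 * Cmv' ^ 4 * C₁ / ct := by positivity
    rw [hLc]
    linarith
  have hLc0 : 0 < Lc := by linarith
  set δ : ℝ := Real.exp (-Lc) / 2 with hδ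
  have hδ0 : 0 < δ := by positivity
  have h2δ : 2 * δ = Real.exp (-Lc) := by rw [hδ]; ring
  have h2δ1 : 2 * δ < 1 := by rw [h2δ]; exact Real.exp_lt_one_iff.2 (by linarith)
  have hδ1 : δ < 1 := by linarith
  have hlogδ : Real.log (1 / (2 * δ)) = Lc := by rw [h2δ, one_div, Real.log_inv, Real.log_exp, neg_neg]
  set ε : ℝ := δ / 4 with hε
  have hε0 : 0 < ε := by positivity
  have hε1 : ε ≤ 1 := by rw [hε]; linarith
  set θ : ℝ := Real.sqrt ct / 2 with hθ
  have hsct0 : 0 < Real.sqrt ct := Real.sqrt_pos.2 hct0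
  have hsct : Real.sqrt ct ≤ 1 / 2 := by
    rw [show (1 / 2 : ℝ) = Real.sqrt (1 / 4) by
      rw [show (1 / 4 : ℝ) = (1 / 2) ^ 2 by norm_num, Real.sqrt_sq (by norm_num)]]
    exact Real.sqrt_le_sqrt (by linarith)
  have hsct2 : Real.sqrt ct ^ 2 = ct := Real.sq_sqrt hct0.le
  have hθ0 : 0 < θ := by positivity
  have hθ1 : θ ≤ 1 := by rw [hθ]; linarith
  set ρ₀ : ℝ := P / Real.sqrt ct with hρ₀
  have hρ₀0 : 0 < ρ₀ := by positivity
  refine ⟨θ, 1 - δ / 4, ρ₀, hθ0, hθ1, by linarith, by linarith, hρ₀0, ?_⟩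
  intro ρ hρ₀ρ F N b Φ hF2 hFa hF0 hFp hb1 hbdiv hbp _ hΦ1 hΦp hΦz hΦb hN heq hFc hF1c hNm hNi m M hmM p hp q hq
  -- ### elementary consequences
  have hρ : 0 < ρ := hρ₀0.trans_le hρ₀ρ
  have hPρ₁ : P ≤ Real.sqrt ct * ρ := by
    have h := mul_le_mul_of_nonneg_left hρ₀ρ hsct0.le
    rw [hρ₀, mul_div_cancel₀ _ hsct0.ne'] at h
    exact h
  have hρ' : 0 < Real.sqrt ct * ρ := by positivity
  have hρ'ρ : Real.sqrt ct * ρ ≤ ρ := by nlinarith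
  have hρ'2 : Real.sqrt ct * ρ ≤ ρ / 2 := by nlinarith
  have hPρ : P ≤ ρ := hPρ₁.trans hρ'ρ
  have hρ'sq : (Real.sqrt ct * ρ) ^ 2 = ct * ρ ^ 2 := by rw [mul_pow, hsct2]
  have hθρ : θ * ρ = Real.sqrt ct * ρ / 2 := by rw [hθ]; ring
  have hΦb' : ∀ s x, |Φ s x| ≤ CΦ' * cylRadius x := fun s x =>
    (hΦb s x).trans (mul_le_mul_of_nonneg_right (le_max_left _ _) (cylRadius_nonneg x))
  -- the small cylinder lies in the big one
  have hsmall : Icc (-(θ * ρ) ^ 2) 0 ×ˢ {x : EuclideanSpace ℝ (Fin 3) | cylRadius x ≤ θ * ρ} ⊆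
      Icc (-ρ ^ 2) 0 ×ˢ {x : EuclideanSpace ℝ (Fin 3) | cylRadius x ≤ ρ} := by
    refine prod_mono (Icc_subset_Icc (by nlinarith [hθ0, hθ1]) le_rfl) fun x hx => ?_
    have : θ * ρ ≤ ρ := by nlinarith
    exact le_trans hx this
  -- `m ≤ 0 ≤ M` (the axis meets the cylinder)
  have h00 : F 0 0 = 0 := hF0 0 0 (by simp [cylRadius])
  have hm0 : m ≤ 0 ∧ 0 ≤ M := by
    have h := hmM 0 ⟨by nlinarith, le_rfl⟩ 0 (by
      have : cylRadius (0 : EuclideanSpace ℝ (Fin 3)) = 0 := by simp [cylRadius]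
      rw [this]; exact hρ.le)
    rw [h00] at h; exact h
  set J : ℝ := M - m with hJ
  have hJ0 : 0 ≤ J := by rw [hJ]; linarith [hm0.1, hm0.2]
  -- the trivial bound `F p − F q ≤ J`
  have hFp' := hmM p.1 (hsmall hp).1 p.2 (hsmall hp).2
  have hFq' := hmM q.1 (hsmall hq).1 q.2 (hsmall hq).2
  rcases hJ0.eq_or_lt with hJ00 | hJpos
  · have : F p.1 p.2 - F q.1 q.2 ≤ 0 := by rw [hJ] at hJ00; linarith [hFp'.2, hFq'.1]
    have : (1 - δ / 4) * (M - m) = 0 := by rw [← hJ, ← hJ00]; ring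
    linarith
  -- ### the key step: `Φ ≥ δ/2` on the small cylinder, for a normalisation `Φ = λF + a`
  have key : ∀ lam a : ℝ, 1 ≤ a →
      (∀ s ∈ Icc (-ρ ^ 2) 0, ∀ x, cylRadius x ≤ ρ → 0 ≤ lam * F s x + a ∧ lam * F s x + a ≤ 2) →
      ∀ p ∈ Icc (-(θ * ρ) ^ 2) 0 ×ˢ {x : EuclideanSpace ℝ (Fin 3) | cylRadius x ≤ θ * ρ},
        δ / 2 ≤ lam * F p.1 p.2 + a := by
    intro lam a ha hΦ
    -- the three bundles: `λF + (a+ε)` at radii `ρ` and `ρ/2`, `λF` at radius `ρ' = √ct ρ`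
    obtain ⟨hF2l, hFal, hFpl, hNl, heql, hFcl, -, hNml, hNil⟩ :=
      bundle_affine_restrict_periodic (lam := lam) (d := a + ε) hρ le_rfl hF2 hFa hFp hN heq hFc hF1c hNm hNi
    obtain ⟨hF2h, hFah, hFph, hNh, heqh, hFch, -, hNmh, hNih⟩ :=
      bundle_affine_restrict_periodic (lam := lam) (d := a + ε) (half_pos hρ) (half_le_self hρ.le) hF2 hFa hFp
        hN heq hFc hF1c hNm hNi
    obtain ⟨hF2v, hFav, hFpv, hNv, heqv, hFcv, hF1cv, hNmv, hNiv⟩ :=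
      bundle_affine_restrict_periodic (lam := lam) (d := 0) hρ' hρ'ρ hF2 hFa hFp hN heq hFc hF1c hNm hNi
    -- bounds of `λF + (a+ε)` on the cylinders and on the axis
    have haxis : ∀ s (z : ℝ), F s (meridianPoint (0, z)) = 0 := fun s z =>
      hF0 s _ (by rw [cylRadius_meridianPoint_eq_abs, abs_zero])
    have hFbl : ∀ s ∈ Icc (-ρ ^ 2) 0, ∀ x, cylRadius x ≤ ρ →
        ε ≤ lam * F s x + (a + ε) ∧ lam * F s x + (a + ε) ≤ 3 := by
      intro s hs x hx
      have h := hΦ s hs x hx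
      constructor <;> linarith [h.1, h.2]
    have hFaxl : ∀ s ∈ Icc (-ρ ^ 2) 0, ∀ z : ℝ, 1 ≤ lam * F s (meridianPoint (0, z)) + (a + ε) := by
      intro s _ z
      rw [haxis]; linarith
    have hIh : Icc (-(ρ / 2) ^ 2) (0 : ℝ) ⊆ Icc (-ρ ^ 2) 0 := Icc_subset_Icc (by nlinarith) le_rfl
    have hFbh : ∀ s ∈ Icc (-(ρ / 2) ^ 2) 0, ∀ x, cylRadius x ≤ ρ / 2 →
        ε ≤ lam * F s x + (a + ε) ∧ lam * F s x + (a + ε) ≤ 3 := fun s hs x hx =>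
      hFbl s (hIh hs) x (hx.trans (half_le_self hρ.le))
    have hFaxh : ∀ s ∈ Icc (-(ρ / 2) ^ 2) 0, ∀ z : ℝ, 1 ≤ lam * F s (meridianPoint (0, z)) + (a + ε) :=
      fun s hs z => hFaxl s (hIh hs) z
    -- Lemma 3.3 at radius `ρ/2`: the mass lower bound
    have hmass0 := hLM hP (half_pos hρ) hε0 hε1 hF2h hFah hFph hb1 hbdiv hbp hΦ1 hΦp hΦz hΦb' hNh heqh hFch hNmh
      hNih hFbh hFaxh
    have hmass : cl / 16 * (P * ρ ^ 4) ≤ ∫ s in (-(ρ ^ 2 / 4))..0,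
        ∫ x in {x : EuclideanSpace ℝ (Fin 3) | x 2 ∈ Icc 0 P ∧ cylRadius x ≤ ρ / 2},
          (lam * F s x + (a + ε)) ^ (1 / 4 : ℝ) := by
      have e1 : cl / 16 * (P * ρ ^ 4) = cl * (P * (ρ / 2) ^ 4) := by ring
      have e2 : -(ρ ^ 2 / 4) = -(ρ / 2) ^ 2 := by ring
      rw [e1, e2]; exact hmass0
    -- Lemma 3.1 at radius `ρ`: the logarithmic estimate
    have hlog := hLE hP hPρ hε0 hε1 hF2l hFal hFpl hb1 hbdiv hbp hΦ1 hΦp hΦz hΦb' hNl heql hFcl hNml hNil hFbl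
      hFaxl hmass
    -- the sublevel sets `{Φ(t) < δ} ∩ ([0,P] × {r ≤ ρ/2})`, for `t ∈ [−ct ρ², 0]`
    obtain ⟨-, hZhi, -⟩ := cylCutoff_sq_slab_mass hP hρ
    have hsub : ∀ t ∈ Icc (-(ct * ρ ^ 2)) 0,
        volume.real ({x | lam * F t x + (a + ε) < 2 * δ} ∩
          {x : EuclideanSpace ℝ (Fin 3) | x 2 ∈ Icc 0 P ∧ cylRadius x ≤ ρ / 2}) ≤ C₁ * (P * ρ ^ 2) / Lc := by
      intro t ht
      have htI : t ∈ Icc (-ρ ^ 2) 0 := ⟨le_trans (by nlinarith) ht.1, ht.2⟩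
      have h := sublevel_measure_le_periodic (P := P) hρ hε0 hδ0 h2δ1 (F := fun x => lam * F t x + (a + ε))
        ((continuous_const.mul (hF2 t).continuous).add continuous_const) (hFbl t htI)
      rw [hlogδ] at h
      have h2 := hlog t ht
      rw [le_div_iff₀ hLc0, hC₁]
      nlinarith [h, h2, hZhi, hlog3]
    -- ### the mean value inequality for `(δ − Φ)₊ = (c − λF)₊`, `c = δ − a ≤ 0`, at radius `ρ'`
    have hc : δ - a ≤ 0 := by linarith
    obtain ⟨hw0, hwc, hHw, hfam⟩ := posPart_const_sub_family hc
    have hF0v : ∀ s x, cylRadius x = 0 → lam * F s x + 0 = 0 := fun s x hx => by rw [hF0 s x hx]; ring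
    have hMVI := hMV hP hρ' hF2v hFav hF0v hFpv hb1 hbdiv hbp hΦ1 hΦp hΦz hCΦ'0 hΦb' hNv heqv hFcv hF1cv hNmv
      hNiv hw0 hwc (Hf := fun m v => max (δ - a - v) 0 ^ m) (sf := fun m v => max (δ - a - v) 0 ^ (m / 2)) hHw hfam
    -- the `L⁴` norm over one period of `Q(ρ')`
    set g : ℝ × EuclideanSpace ℝ (Fin 3) → ℝ := fun p => max (δ - a - (lam * F p.1 p.2 + 0)) 0 with hgdef
    have hgc : Continuous g := (continuous_const.sub ((continuous_const.mul hFc).add continuous_const)).max continuous_const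
    have hg0 : ∀ p, 0 ≤ g p := fun p => le_max_right _ _
    set ρ₁ : ℝ := Real.sqrt ct * ρ with hρ₁
    set Kv : Set (EuclideanSpace ℝ (Fin 3)) := {x | x 2 ∈ Icc 0 P ∧ cylRadius x ≤ ρ₁} with hKv
    set K₂ : Set (EuclideanSpace ℝ (Fin 3)) := {x | x 2 ∈ Icc 0 P ∧ cylRadius x ≤ ρ / 2} with hK₂
    have hKvc : IsCompact Kv := isCompact_box_pos P ρ₁
    have hKvm : MeasurableSet Kv := hKvc.isClosed.measurableSet
    have hK₂c : IsCompact K₂ := isCompact_box_pos P (ρ / 2)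
    have hK₂m : MeasurableSet K₂ := hK₂c.isClosed.measurableSet
    have hIv : Ioc (-ρ₁ ^ 2) (0 : ℝ) ⊆ Icc (-(ct * ρ ^ 2)) 0 := by
      rw [hρ₁, hρ'sq]; exact Ioc_subset_Icc_self
    have hKvK₂ : Kv ⊆ K₂ := fun x hx => ⟨hx.1, hx.2.trans hρ'2⟩
    -- pointwise bound of `g⁴` by `δ⁴ 1_{Φ < δ}` on the period cell
    have hgpt : ∀ s ∈ Ioc (-ρ₁ ^ 2) 0, ∀ x ∈ Kv,
        ‖g (s, x)‖ₑ ^ (4 : ℝ) ≤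
          ({x | lam * F s x + (a + ε) < 2 * δ} ∩ K₂).indicator (fun _ => ENNReal.ofReal (δ ^ 4)) x := by
      intro s hs x hx
      have hsI : s ∈ Icc (-ρ ^ 2) 0 := ⟨le_trans (by nlinarith) (hIv hs).1, hs.2⟩
      have hΦ0 := (hΦ s hsI x (hx.2.trans hρ'ρ)).1
      by_cases hlt : lam * F s x + a < δ
      · have hmem : x ∈ {x | lam * F s x + (a + ε) < 2 * δ} ∩ K₂ := by
          refine ⟨?_, hKvK₂ hx⟩
          show lam * F s x + (a + ε) < 2 * δ
          rw [hε]; linarith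
        rw [indicator_of_mem hmem]
        have hgle : g (s, x) ≤ δ := by
          simp only [hgdef]
          refine max_le ?_ hδ0.le
          linarith
        rw [Real.enorm_eq_ofReal (hg0 _), ENNReal.ofReal_rpow_of_nonneg (hg0 _) (by norm_num)]
        refine ENNReal.ofReal_le_ofReal ?_
        rw [show ((4 : ℝ)) = ((4 : ℕ) : ℝ) by norm_num, Real.rpow_natCast]
        exact pow_le_pow_left₀ (hg0 _) hgle 4
      · have hg00 : g (s, x) = 0 := by
          simp only [hgdef]
          refine max_eq_right ?_
          linarith
        rw [hg00, enorm_zero, ENNReal.zero_rpow_of_pos (by norm_num)]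
        exact bot_le
    -- Tonelli and the sublevel bound: `∫∫ g⁴ ≤ ρ'² δ⁴ C₁ Pρ² / Lc`
    have hBq0 : 0 ≤ ρ₁ ^ 2 * (δ ^ 4 * (C₁ * (P * ρ ^ 2) / Lc)) := by positivity
    have hlint : ∫⁻ z, ‖g z‖ₑ ^ (4 : ℝ) ∂(((volume : Measure ℝ).prod (volume : Measure (EuclideanSpace ℝ (Fin 3)))).restrict
        (Ioc (-ρ₁ ^ 2) 0 ×ˢ Kv)) ≤ ENNReal.ofReal (ρ₁ ^ 2 * (δ ^ 4 * (C₁ * (P * ρ ^ 2) / Lc))) := by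
      rw [← Measure.prod_restrict, lintegral_prod _ (hgc.measurable.enorm.pow_const _).aemeasurable]
      have hinner : ∀ s ∈ Ioc (-ρ₁ ^ 2) (0 : ℝ),
          ∫⁻ x in Kv, ‖g (s, x)‖ₑ ^ (4 : ℝ) ≤ ENNReal.ofReal (δ ^ 4 * (C₁ * (P * ρ ^ 2) / Lc)) := by
        intro s hs
        have hSm : MeasurableSet ({x | lam * F s x + (a + ε) < 2 * δ} ∩ K₂) :=
          (isOpen_lt ((continuous_const.mul (hF2 s).continuous).add continuous_const) continuous_const).measurableSet.inter
            hK₂m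
        have hSfin : volume ({x | lam * F s x + (a + ε) < 2 * δ} ∩ K₂) ≠ ∞ :=
          measure_ne_top_of_subset inter_subset_right hK₂c.measure_lt_top.ne
        calc ∫⁻ x in Kv, ‖g (s, x)‖ₑ ^ (4 : ℝ)
            ≤ ∫⁻ x in Kv, ({x | lam * F s x + (a + ε) < 2 * δ} ∩ K₂).indicator
                  (fun _ => ENNReal.ofReal (δ ^ 4)) x :=
              setLIntegral_mono' hKvm fun x hx => hgpt s hs x hx
          _ ≤ ∫⁻ x, ({x | lam * F s x + (a + ε) < 2 * δ} ∩ K₂).indicator (fun _ => ENNReal.ofReal (δ ^ 4)) x :=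
              setLIntegral_le_lintegral _ _
          _ = ENNReal.ofReal (δ ^ 4) * volume ({x | lam * F s x + (a + ε) < 2 * δ} ∩ K₂) := by
              rw [lintegral_indicator hSm, setLIntegral_const]
          _ ≤ ENNReal.ofReal (δ ^ 4) * ENNReal.ofReal (C₁ * (P * ρ ^ 2) / Lc) := by
              have hv : volume ({x | lam * F s x + (a + ε) < 2 * δ} ∩ K₂) ≤ ENNReal.ofReal (C₁ * (P * ρ ^ 2) / Lc) := by
                rw [← ofReal_measureReal hSfin]
                exact ENNReal.ofReal_le_ofReal (hsub s (hIv hs))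
              gcongr
          _ = ENNReal.ofReal (δ ^ 4 * (C₁ * (P * ρ ^ 2) / Lc)) := (ENNReal.ofReal_mul (by positivity)).symm
      calc ∫⁻ s in Ioc (-ρ₁ ^ 2) (0 : ℝ), ∫⁻ x in Kv, ‖g (s, x)‖ₑ ^ (4 : ℝ)
          ≤ ∫⁻ s in Ioc (-ρ₁ ^ 2) (0 : ℝ), ENNReal.ofReal (δ ^ 4 * (C₁ * (P * ρ ^ 2) / Lc)) :=
            setLIntegral_mono' measurableSet_Ioc fun s hs => hinner s hs
        _ = ENNReal.ofReal (δ ^ 4 * (C₁ * (P * ρ ^ 2) / Lc)) * volume (Ioc (-ρ₁ ^ 2) (0 : ℝ)) := setLIntegral_const _ _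
        _ = ENNReal.ofReal (ρ₁ ^ 2 * (δ ^ 4 * (C₁ * (P * ρ ^ 2) / Lc))) := by
            rw [Real.volume_Ioc, sub_neg_eq_add, zero_add, mul_comm, ← ENNReal.ofReal_mul (by positivity)]
    have h4 : eLpNorm g (ENNReal.ofReal 4) ((((volume : Measure ℝ).prod (volume : Measure (EuclideanSpace ℝ (Fin 3)))).restrict
        (Ioc (-ρ₁ ^ 2) 0 ×ˢ Kv))) ≤
        ENNReal.ofReal ((ρ₁ ^ 2 * (δ ^ 4 * (C₁ * (P * ρ ^ 2) / Lc))) ^ (1 / 4 : ℝ)) := by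
      rw [eLpNorm_eq_lintegral_rpow_enorm_toReal (by norm_num) ENNReal.ofReal_ne_top, ENNReal.toReal_ofReal (by norm_num),
        ← ENNReal.ofReal_rpow_of_nonneg hBq0 (by norm_num)]
      exact ENNReal.rpow_le_rpow hlint (by norm_num)
    -- ### the `L∞` bound: `(δ − Φ)₊ ≤ X ≤ δ/2` on one period of `Q(ρ'/2)`
    have hρP : 0 < 1 + ρ₁ / P := by positivity
    set X : ℝ := Cmv' * (1 + ρ₁ / P) ^ (1 / 4 : ℝ) * ρ₁ ^ (-(5 / 4 : ℝ)) *
      (ρ₁ ^ 2 * (δ ^ 4 * (C₁ * (P * ρ ^ 2) / Lc))) ^ (1 / 4 : ℝ) with hX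
    have hX0 : 0 ≤ X := by positivity
    have hsup : eLpNorm g ∞ ((((volume : Measure ℝ).prod (volume : Measure (EuclideanSpace ℝ (Fin 3)))).restrict
        (Ioc (-(ρ₁ / 2) ^ 2) 0 ×ˢ {x : EuclideanSpace ℝ (Fin 3) | x 2 ∈ Icc 0 P ∧ cylRadius x ≤ ρ₁ / 2}))) ≤
        ENNReal.ofReal X := by
      refine hMVI.trans ?_
      calc ENNReal.ofReal (Cmv * (1 + CΦ' ^ 2) ^ (5 / 8 : ℝ) * (1 + ρ₁ / P) ^ (1 / 4 : ℝ) * ρ₁ ^ (-(5 / 4 : ℝ))) *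
            eLpNorm g (ENNReal.ofReal 4)
              ((((volume : Measure ℝ).prod (volume : Measure (EuclideanSpace ℝ (Fin 3)))).restrict (Ioc (-ρ₁ ^ 2) 0 ×ˢ Kv)))
          ≤ ENNReal.ofReal (Cmv * (1 + CΦ' ^ 2) ^ (5 / 8 : ℝ) * (1 + ρ₁ / P) ^ (1 / 4 : ℝ) * ρ₁ ^ (-(5 / 4 : ℝ))) *
              ENNReal.ofReal ((ρ₁ ^ 2 * (δ ^ 4 * (C₁ * (P * ρ ^ 2) / Lc))) ^ (1 / 4 : ℝ)) := by gcongr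
        _ = ENNReal.ofReal X := by
            rw [hX, hCmv', ENNReal.ofReal_mul
              (p := Cmv * (1 + CΦ' ^ 2) ^ (5 / 8 : ℝ) * (1 + ρ₁ / P) ^ (1 / 4 : ℝ) * ρ₁ ^ (-(5 / 4 : ℝ))) (by positivity)]
    -- `X ≤ δ/2`: `X⁴ = Cmv'⁴ (1 + ρ₁/P) ρ₁^{-5} ρ₁² δ⁴ C₁ Pρ² / Lc ≤ δ⁴/16`
    have hXle : X ≤ δ / 2 := by
      have hA4 : (ρ₁ ^ (-(5 / 4 : ℝ))) ^ 4 = (ρ₁ ^ 5)⁻¹ := by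
        rw [← Real.rpow_natCast (ρ₁ ^ (-(5 / 4 : ℝ))) 4, ← Real.rpow_mul hρ'.le,
          show (-(5 / 4 : ℝ)) * ((4 : ℕ) : ℝ) = -((5 : ℕ) : ℝ) by norm_num, Real.rpow_neg hρ'.le, Real.rpow_natCast]
      have hB4 : ((ρ₁ ^ 2 * (δ ^ 4 * (C₁ * (P * ρ ^ 2) / Lc))) ^ (1 / 4 : ℝ)) ^ 4 =
          ρ₁ ^ 2 * (δ ^ 4 * (C₁ * (P * ρ ^ 2) / Lc)) := by
        rw [← Real.rpow_natCast _ 4, ← Real.rpow_mul hBq0, show (1 / 4 : ℝ) * ((4 : ℕ) : ℝ) = 1 by norm_num, Real.rpow_one]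
      have hC4 : ((1 + ρ₁ / P) ^ (1 / 4 : ℝ)) ^ 4 = 1 + ρ₁ / P := by
        rw [← Real.rpow_natCast _ 4, ← Real.rpow_mul hρP.le, show (1 / 4 : ℝ) * ((4 : ℕ) : ℝ) = 1 by norm_num,
          Real.rpow_one]
      have hX4 : X ^ 4 = Cmv' ^ 4 * (δ ^ 4 * (C₁ / Lc)) *
          ((1 + ρ₁ / P) * (ρ₁ ^ 5)⁻¹ * (ρ₁ ^ 2 * (P * ρ ^ 2))) := by
        rw [hX, mul_pow, mul_pow, mul_pow, hA4, hB4, hC4]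
        field_simp
      -- the geometric factor: `(1 + ρ₁/P) ρ₁² Pρ²/ρ₁⁵ = (P + ρ₁)ρ²/ρ₁³ ≤ 2/ct` since `P ≤ ρ₁ = √ct ρ`
      have hgeom : (1 + ρ₁ / P) * (ρ₁ ^ 5)⁻¹ * (ρ₁ ^ 2 * (P * ρ ^ 2)) ≤ 2 / ct := by
        have hρ₁ne : ρ₁ ≠ 0 := hρ'.ne'
        have hPne : P ≠ 0 := hP.ne'
        have h1 : 1 + ρ₁ / P ≤ 2 * ρ₁ / P := by
          rw [le_div_iff₀ hP, add_mul, one_mul, div_mul_cancel₀ _ hPne]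
          linarith
        have hpos : 0 ≤ (ρ₁ ^ 5)⁻¹ * (ρ₁ ^ 2 * (P * ρ ^ 2)) := by positivity
        have e1 : (2 * ρ₁ / P) * ((ρ₁ ^ 5)⁻¹ * (ρ₁ ^ 2 * (P * ρ ^ 2))) = 2 * ρ ^ 2 / ρ₁ ^ 2 := by
          field_simp
        have e2 : 2 * ρ ^ 2 / ρ₁ ^ 2 = 2 / ct := by
          rw [hρ'sq, mul_comm ct, ← div_div, mul_div_assoc, div_self (pow_ne_zero 2 hρ.ne'), mul_one]
        calc (1 + ρ₁ / P) * (ρ₁ ^ 5)⁻¹ * (ρ₁ ^ 2 * (P * ρ ^ 2))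
            = (1 + ρ₁ / P) * ((ρ₁ ^ 5)⁻¹ * (ρ₁ ^ 2 * (P * ρ ^ 2))) := by ring
          _ ≤ (2 * ρ₁ / P) * ((ρ₁ ^ 5)⁻¹ * (ρ₁ ^ 2 * (P * ρ ^ 2))) := mul_le_mul_of_nonneg_right h1 hpos
          _ = 2 / ct := by rw [e1, e2]
      have hbound : Cmv' ^ 4 * (C₁ / Lc) * (2 / ct) ≤ 1 / 16 := by
        have e : Cmv' ^ 4 * (C₁ / Lc) * (2 / ct) = (32 * Cmv' ^ 4 * C₁ / ct) / Lc / 16 := by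
          field_simp
          ring
        rw [e, div_le_iff₀ (by norm_num : (0 : ℝ) < 16), div_le_iff₀ hLc0, hLc]
        nlinarith [show 0 ≤ 32 * Cmv' ^ 4 * C₁ / ct by positivity]
      have hX4le : X ^ 4 ≤ (δ / 2) ^ 4 := by
        rw [hX4, show (δ / 2) ^ 4 = 1 / 16 * δ ^ 4 by ring]
        have h1 : Cmv' ^ 4 * (δ ^ 4 * (C₁ / Lc)) * ((1 + ρ₁ / P) * (ρ₁ ^ 5)⁻¹ * (ρ₁ ^ 2 * (P * ρ ^ 2))) ≤
            Cmv' ^ 4 * (δ ^ 4 * (C₁ / Lc)) * (2 / ct) := mul_le_mul_of_nonneg_left hgeom (by positivity)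
        have h2 : Cmv' ^ 4 * (δ ^ 4 * (C₁ / Lc)) * (2 / ct) = (Cmv' ^ 4 * (C₁ / Lc) * (2 / ct)) * δ ^ 4 := by ring
        rw [h2] at h1
        exact h1.trans (mul_le_mul_of_nonneg_right hbound (by positivity))
      exact (pow_le_pow_iff_left₀ hX0 (by positivity) (by norm_num : (4 : ℕ) ≠ 0)).1 hX4le
    -- from the essential supremum over one period cell to every point of the closed small cylinder
    have hper : ∀ t : ℝ, Function.Periodic (fun x => g (t, x)) (P • eZ) := by
      intro t x
      have h : F t (x + P • eZ) = F t x := hFp t x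
      simp only [hgdef]
      rw [h]
    have hall := forall_le_of_eLpNorm_top_periodCell_le hgc hg0 hP (half_pos hρ') hX0 hper hsup
    -- conclude
    intro p' hp'
    have hpz : p' ∈ Icc (-(ρ₁ / 2) ^ 2) 0 ×ˢ {x : EuclideanSpace ℝ (Fin 3) | cylRadius x ≤ ρ₁ / 2} := by
      have e : θ * ρ = ρ₁ / 2 := by rw [hρ₁]; exact hθρ
      rw [e] at hp'; exact hp'
    have h1 := hall p' hpz
    have h2 : δ - a - (lam * F p'.1 p'.2 + 0) ≤ g p' := le_max_left _ _
    linarith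
  -- ### the two normalisations
  have hJne : J ≠ 0 := hJpos.ne'
  by_cases ha₁ : 1 ≤ -2 * m / J
  · -- `Φ = 2(F − m)/J = (2/J) F + (−2m/J)`
    have hΦn : ∀ s ∈ Icc (-ρ ^ 2) 0, ∀ x, cylRadius x ≤ ρ →
        0 ≤ 2 / J * F s x + -2 * m / J ∧ 2 / J * F s x + -2 * m / J ≤ 2 := by
      intro s hs x hx
      obtain ⟨h1, h2⟩ := hmM s hs x hx
      have e : 2 / J * F s x + -2 * m / J = 2 * (F s x - m) / J := by field_simp; ring
      rw [e]
      constructor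
      · exact div_nonneg (by linarith) hJpos.le
      · rw [div_le_iff₀ hJpos, hJ]; linarith
    have hk := key (2 / J) (-2 * m / J) ha₁ hΦn q hq
    have e : 2 / J * F q.1 q.2 + -2 * m / J = 2 * (F q.1 q.2 - m) / J := by field_simp; ring
    rw [e, le_div_iff₀ hJpos] at hk
    linarith [hFp'.2, hk, hJ]
  · -- `Φ = 2(M − F)/J = (−2/J) F + 2M/J`
    have hmJ : -2 * m / J + 2 * M / J = 2 := by
      field_simp
      rw [hJ]; ring
    have ha₂ : 1 ≤ 2 * M / J := by linarith
    have hΦn : ∀ s ∈ Icc (-ρ ^ 2) 0, ∀ x, cylRadius x ≤ ρ →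
        0 ≤ -2 / J * F s x + 2 * M / J ∧ -2 / J * F s x + 2 * M / J ≤ 2 := by
      intro s hs x hx
      obtain ⟨h1, h2⟩ := hmM s hs x hx
      have e : -2 / J * F s x + 2 * M / J = 2 * (M - F s x) / J := by field_simp; ring
      rw [e]
      constructor
      · exact div_nonneg (by linarith) hJpos.le
      · rw [div_le_iff₀ hJpos, hJ]; linarith
    have hk := key (-2 / J) (2 * M / J) ha₂ hΦn p hp
    have e : -2 / J * F p.1 p.2 + 2 * M / J = 2 * (M - F p.1 p.2) / J := by field_simp; ring
    rw [e, le_div_iff₀ hJpos] at hk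
    linarith [hFq'.1, hk, hJ]

end LeiRenZhang2019

end Literature.Analysis.FluidPDE

end
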